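import Literature.MathematicalPhysics.QuantumFieldTheory.Balaban1983to89.B8Thm8SurvivingZdGF3HP2MapLanEGamma
import Literature.MathematicalPhysics.QuantumFieldTheory.Balaban1983to89.B8LeafModelZdHP2PerTransfer

/-!
# `Balaban1983to89.B8Thm8SurvivingZdGF3HP2PerMapLanEGamma` — [Balaban1985RegularSpaces] THEOREM 8 (p. 101), SURVIVING FORM, ON THE PERIODIC SUB-MODEL
# `B8LeafModelZdHP2Per.zdGF3HP₂Per` OF THE EDITION-δ₂ P-CARRIER (print's «Ω_j ⊂ T_η», p. 77) — THE «EXACTLY ONE ⇒ PERIODIC» DEVICE RUN ON THEOREM 8's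
# THEOREM-4-SHAPED CORE (exit E8a of the cell's (β′-PERIODIC) road; dag-n05-c LOCATED: the surviving form's own uniqueness clause is among competitors carrying
# (1.36) ∕ (1.39), more than its existence clause grants, so it does not transfer as typed — the CORE's «exactly one» is among `Restricted ∧ (1.146) ∧ (1.62)`
# competitors, all three granted and all three translation covariant)

statement-level skeleton of published theorems with citation tags; proofs where landed; nothing here is a claim about the Yang–Mills mass gap

T. Bałaban, *Spaces of regular gauge field configurations on a lattice and gauge fixing conditions*, Commun. Math. Phys. **99** (1985) 75–102
`[Balaban1985RegularSpaces]` ("B8"): Thm 8 (1.146) p. 101 («there exists exactly one gauge transformation u … satisfying (1.29)»), Thm 4 p. 88, (1.29) p. 81,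
(1.62) p. 87, (1.65)–(1.66) pp. 87–88, p. 77 («Ω_j ⊂ T_η … we admit Ω_j = T_η»); [4] = [Balaban1985BackgroundPropagators] (3.40) p. 397.
PDF held: `paper:balaban1985-cmp99-regular-spaces-gauge-fixing` (journal page = PDF page + 74).

CITATION HEADER (lean-in-tree rule).  Cell `pub-ymgap` (HUMAN RULING D-0062, Track A), DAG node N05 = [B8], seat `pub-ymgap-dag-n05-d` (g14; P4 pen of plan PENS-217,
director-ym №217 (ii) ∕ №220 A-4 ∕ №222 A-5′).
WHY THIS FILE.  On the (β′-PERIODIC) road the [B8] leaf is read on the periodic sub-model `zdGF3HP₂Per 𝔸 L β len i P` (dag-n05-c P1′, p641891): `P`-periodic data on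
`ℤᵈ`, every predicate the ℤᵈ member `zdGF3HP₂`'s at the underlying fields.  Theorems 2 and 4 transfer by dag-n05-c's `B8LeafModelZdHP2PerTransfer` (their printed
«exactly one» is among competitors carrying exactly the granted clauses).  Theorem 8's SURVIVING form `B8Thm8Surviving.Thm8SurvivingAt` does NOT transfer as typed (its
uniqueness antecedent demands (1.36) ∧ (1.39), granted only under the inspected source size).  THIS FILE runs the device one level down: the landed ℤᵈ server
`B8Thm8SurvivingZdGF3HP2MapLanEGamma.thm8SurvivingAt_zdGF3HP₂_map_lanE_γ'` (p600532's lineage) supplies existence, every clause and the strong uniqueness at the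
underlying fields; Theorem 8's Theorem-4-shaped CORE `B8Thm4CoreZdGF3HPLanEGamma.thm4Core_zdGF3HP_map_lanE_γ'` at the same shifted pair `(α₀, α″ := 11d²(α₀+α₁) + α₁)`
identifies the server's solution `u` with its own (weak «exactly one»: `Restricted ∧ LanF ∧ (1.62)-shape at 5dLB₈(α₀+α″) = B₁(α₀+α₁)`, all granted to `u`), and every
period-translate `t_{P·m}u` is again such a competitor (dag-n05-c's `restr129_shiftCfg_of_periodic`, `landauFW_shiftCfg_of_periodic`, `c162_shiftCfg_of_periodic` at
periodic `U₀, U′, f`), hence equals `u`: the solution is periodic and lifts to the periodic member's gauge group; uniqueness in the periodic class is the ℤᵈ one.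

WHAT THIS FILE PROVES (one theorem, no `def`).
★★★ `thm8SurvivingAt_zdGF3HP₂Per_map_lanE_γ'` — the hypotheses of `thm8SurvivingAt_zdGF3HP₂_map_lanE_γ'` VERBATIM, plus a period map `p : J → ℕ` with three of the
periodicity binders of dag-n05-c's transfer′ (`hΩ`, `hdvd`, `hΛs`; the bond-class binder `hΛbP` is not needed: (1.37) is not among the core's competitor clauses) ⊢
`B8Thm8Surviving.Thm8SurvivingAt γ (5dL·B₈·(1+11d²)) (5dL·B₀β·(1+11d²)) (fun a => zdGF3HP₂Per 𝔸 L β len (ι a) (p a))`.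

HONEST SCOPE.  Re-keying ∕ assembly BY NAME + the translation-covariance device; the five sourced sockets (`SP5base` ∕ `SP5` ∕ `SH59src` ∕ `SP5u` ∕ `SP3src`) remain
HYPOTHESES at `ι a` exactly as in the ℤᵈ server; no estimate is proved here beyond the cited assembly; constants unchanged (threshold shrunk to meet the core's and
two window thresholds at `(1+11d²)(α₀+α₁)`); `≤` where print has `<`; print's torus `T_η` read on its universal cover as `P`-periodic data on `ℤᵈ`.  Count-neutral;
N05 NOT discharged; one finite `T⁴` programme at fixed `ε`; nothing continuum ∕ ℝ⁴ ∕ OS ∕ mass-gap ∕ Clay.  No `sorry`, no `def`, no `instance`, no `notation`.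
Unit `pub-ymgap-dag-n05-d` (g14), 2026-08-28.
-/

noncomputable section

open NormedSpace

namespace Literature.MathematicalPhysics.QuantumFieldTheory.Balaban1983to89.B8Thm8SurvivingZdGF3HP2PerMapLanEGamma

open MatrixLog B7Prop1Explicit B7Prop2Explicit B7Prop1Local B7Eq92Concrete
open B7Prop2Explicit (C0 c2')
open B8Ineq132 (covDerivFwd InAk BondTouches)
open B8Eq119TwistedAxial (Restr129 InAx)
open B8Eq184Proof (gaugeExp cfgExp)
open B8Lemma1NonAbelian (mulCfg)
open B8Eq140Level (SideTouches)
open B8Eq146AExpansion (iEta)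
open B7Prop4GeneralLevels (logCovIter linCovIter)
open B8Eq155JBound (Jcur wsup)
open B8ScaledSupNorm (bondNorm msup)
open B8Thm2LogB (blockTop)
open B8Ineq130 (tlo thi)
open B8Eq138LandauZd (IsLandau146W InR138 logCfg)
open B8Thm4Windows (thm4_windows)
open B8LeafModelZd (ZdIdx)
open B8LeafModelZd3 (zdGF3)
open B8LeafModelZd3P (zdGF3P zdGF3HP)
open B8LeafModelZd3P2 (zdGF3P₂ zdGF3HP₂)
open B8LeafModelZdHP2Per (zdGF3HP₂Per cfgZdH pertZdH gtZdH srcZdH)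
open B8LeafModelZdPerTransfer (period_smul_eq_pow_smul restr129_shiftCfg_of_periodic c162_shiftCfg_of_periodic)
open B8LeafModelZdHP2PerTransfer (landauFW_shiftCfg_of_periodic)
open B8TowerBondsPrinted (towerBondsP)
open B8ScaledSupNorm (Bdd)
open B8Ineq166Univ (norm_pert_sub_one_le_univ)
open B8Thm4CoreZdGF3HPLanEGamma (thm4Core_zdGF3HP_map_lanE_γ')
open B8Thm8SurvivingZdGF3HP2MapLanEGamma (thm8SurvivingAt_zdGF3HP₂_map_lanE_γ')
open T4TermwiseTorus (IsPeriodic)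
open B12Ineq417Flat (shiftCfg shiftCfg_apply)
open B7TranslationCovariance (mgauge_shiftCfg)

-- `Site` alone could resolve to the torus sites of `Setup.lean`; re-export the `ℤ^d` sites of `B7Prop1Explicit`.
export B7Prop1Explicit (Site)

variable {d : ℕ}

/-! ## Theorem 8 surviving on the periodic sub-model `zdGF3HP₂Per ∘ (ι, p)`, E currency, edition γ′ -/

section Thm8Per

variable {𝔸 : Type} [CStarAlgebra 𝔸] [Nontrivial 𝔸]

/-- ★★★ **THEOREM 8 IN ITS SURVIVING FORM ON THE PERIODIC SUB-MODEL OF THE EDITION-δ₂ P-CARRIER, OVER AN INDEX MAP AND A PERIOD MAP, MODULO THE SOURCED SOCKETS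
AT `ι a` (EDITION γ′)** — the hypotheses of the ℤᵈ server `thm8SurvivingAt_zdGF3HP₂_map_lanE_γ'` VERBATIM, plus `p : J → ℕ` with: every `Ω_l` of `ι a` is
`p a`-periodic, `L^k ∣ p a`, and the top towers `Λs k l` (`l ≤ k`) are `(p a ∕ Lˡ)`-periodic in level-`l` labels
(the (1.5)-index's faces, dag-n05-w2 ∕ `B8PeriodicMemberGeometry`).  PROOF (no re-run of the knit): the periodic member's hypotheses ARE the ℤᵈ member's at the
underlying fields, so the ℤᵈ server yields `u` with (1.29), (1.62), (1.37), (1.146), the conditional (1.36) ∧ (1.39) and the strong «exactly one»; the Theorem-4-shaped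
core at the shifted pair `(α₀, α″)` (its (1.66)₀ antecedent from (1.65) by `B8Ineq166Univ`, as in the server) has a weak «exactly one» among `Restricted ∧ LanF ∧
(1.62)-shape` competitors which `u` meets, so `u` is the core's solution; each translate `t_{(p a)·m} u` meets it too (translation covariance of the three clauses at the
periodic data), hence `t_{(p a)·m} u = u`: `u` is periodic, lifts to the periodic gauge group, and carries every clause there; uniqueness among periodic competitors is
the ℤᵈ one restricted. [cite: Balaban1985RegularSpaces, Thm 8 (1.146) p.101 («exactly one»), Thm 4 p.88, (1.29) p.81, (1.62) p.87, (1.65)–(1.66) pp.87–88, p.77 («Ω_j ⊂ T_η»)] -/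
theorem thm8SurvivingAt_zdGF3HP₂Per_map_lanE_γ' (hd2 : 2 ≤ d) {L : ℕ} (hL : 2 ≤ L) {β : ℝ} {len : Site d → ℝ}
    {B₀ B₀' B₀β cu cP cP3 γ γ' B₈ : ℝ} (hB₀ : 0 < B₀) (hB₀' : 0 < B₀') (hcu : 0 < cu) (hcP : 0 < cP) (hcP3 : 0 < cP3)
    (hγ : 0 < γ) (hγ' : 0 ≤ γ') (hB₈ : 0 < B₈) (hB₀8 : B₀ ≤ B₈) (hB : 2 ≤ 5 * (d : ℝ) * L * B₈)
    (hγB : 5 * (d : ℝ) * L * B₀ + 2 * (γ' * B₀) ≤ 5 * (d : ℝ) * L * B₈)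
    {J : Type} (ι : J → ZdIdx d L) (hΩ0 : ∀ a : J, (ι a).Ω 0 = Set.univ)
    -- the tower law at EVERY truncation of every member ((1.5)–(1.6) p. 77; `IdxB8Sub.tower_all` at the law members)
    (htw : ∀ a : J, ∀ m, m ≤ (ι a).k → ∀ j, j ≤ m → ∀ y ∈ (ι a).Λs m j, ∀ x, InBox (tlo L y j) (thi L y j) x → x ∈ (ι a).Ω j)
    (LanF : J → (Site d → Fin d → 𝔸ˣ) → (Site d → 𝔸) → ℕ → (Site d → Fin d → 𝔸ˣ) → Prop)
    (hLanF : ∀ (a : J) (U₀ : Site d → Fin d → 𝔸ˣ) (f : Site d → 𝔸) (W : Site d → Fin d → 𝔸ˣ),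
      LanF a U₀ f (ι a).k W ↔ IsLandau146W L (ι a).k (ι a).η ((ι a).Ω 0) ((ι a).Λs (ι a).k) U₀ f W)
    (SP5base : ∀ a : J, ∀ α₀ α₁ : ℝ, 0 < α₀ → 0 < α₁ → α₀ + α₁ ≤ cP →
      ∀ U₀ U' : Site d → Fin d → 𝔸ˣ, (∀ x κ, U₀ x κ ∈ unitaryUnits 𝔸) → (∀ x κ, U' x κ ∈ unitaryUnits 𝔸) →
      ∀ φ : Site d → 𝔸, ((InR138 L (ι a).k (ι a).η ((ι a).Ω 0) ((ι a).Λs (ι a).k) U₀ φ ∧ (∀ x, IsSelfAdjoint (φ x)) ∧ (∀ x, x ∉ (ι a).Ω 0 → φ x = 0) ∧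
          Bdd L (ι a).k (ι a).η (-(2 : ℝ)) (fun j (x : Site d) => x ∈ (ι a).Ω j) φ) ∧
        msup L (ι a).k (ι a).η (-(2 : ℝ)) (fun j (x : Site d) => x ∈ (ι a).Ω j) φ < γ * (α₀ + α₁)) →
      InAk L (ι a).k (ι a).η α₀ (ι a).Ω U₀ → InAk L (ι a).k (ι a).η α₀ (ι a).Ω (mulCfg U' U₀) → (∀ m, m ≤ (ι a).k → InAx L m ((ι a).Λs m) U₀ (mulCfg U' U₀)) →
      (∀ j, j ≤ (ι a).k → ∀ (z : Site d) (μ : Fin d),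
        ((∀ x, InBox (tlo L z j) (thi L z j) x → x ∈ (ι a).Ω j) ∨ (∀ x, InBox (tlo L (z + e μ) j) (thi L (z + e μ) j) x → x ∈ (ι a).Ω j)) →
        ‖(avgIter L (mulCfg U' U₀) j z μ : 𝔸) - (avgIter L U₀ j z μ : 𝔸)‖ ≤ α₁) →
      (∀ b ∈ {b : Site d × Fin d | SideTouches ((ι a).Ω 0) b.1 b.2}, ‖((U' b.1 b.2 : 𝔸ˣ) : 𝔸) - 1‖ ≤ α₁) →
      (∃ (v : Site d → 𝔸ˣ) (lam : Site d → 𝔸), (∀ x, v x ∈ unitaryUnits 𝔸) ∧ (∀ x, x ∉ (ι a).Ω 0 → v x = 1) ∧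
        (∀ j, j ≤ 1 → ∀ b ∈ {b : Site d × Fin d | SideTouches ((ι a).Ω j) b.1 b.2}, (v b.1 : 𝔸) = ((gaugeExp lam b.1 : 𝔸ˣ) : 𝔸) ∧
        (v (b.1 + e b.2) : 𝔸) = ((gaugeExp lam (b.1 + e b.2) : 𝔸ˣ) : 𝔸)) ∧
        (∀ j, j ≤ 1 → ∀ b ∈ {b : Site d × Fin d | SideTouches ((ι a).Ω j) b.1 b.2},
        ‖lam b.1‖ ≤ (8 * B₀' * (5 * (d : ℝ) * L * B₈) * (α₀ + α₁)) ∧ ((L : ℝ) ^ j * (ι a).η) * ‖covDerivFwd (ι a).η U₀ b.2 lam b.1‖ ≤ (8 * B₀' * (5 * (d : ℝ) * L * B₈) * (α₀ + α₁))) ∧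
        LanF a U₀ φ 1 (mgauge U₀ v⁻¹ U') ∧ Restr129 L 1 ((ι a).Λs 1) U₀ ((1 : Site d → 𝔸ˣ) * v)))
    (SP5 : ∀ a : J, ∀ α₀ α₁ : ℝ, 0 < α₀ → 0 < α₁ → α₀ + α₁ ≤ cP →
      ∀ U₀ U' : Site d → Fin d → 𝔸ˣ, (∀ x κ, U₀ x κ ∈ unitaryUnits 𝔸) → (∀ x κ, U' x κ ∈ unitaryUnits 𝔸) →
      ∀ φ : Site d → 𝔸, ((InR138 L (ι a).k (ι a).η ((ι a).Ω 0) ((ι a).Λs (ι a).k) U₀ φ ∧ (∀ x, IsSelfAdjoint (φ x)) ∧ (∀ x, x ∉ (ι a).Ω 0 → φ x = 0) ∧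
          Bdd L (ι a).k (ι a).η (-(2 : ℝ)) (fun j (x : Site d) => x ∈ (ι a).Ω j) φ) ∧
        msup L (ι a).k (ι a).η (-(2 : ℝ)) (fun j (x : Site d) => x ∈ (ι a).Ω j) φ < γ * (α₀ + α₁)) →
      InAk L (ι a).k (ι a).η α₀ (ι a).Ω U₀ → InAk L (ι a).k (ι a).η α₀ (ι a).Ω (mulCfg U' U₀) → (∀ m, m ≤ (ι a).k → InAx L m ((ι a).Λs m) U₀ (mulCfg U' U₀)) →
      (∀ j, j ≤ (ι a).k → ∀ (z : Site d) (μ : Fin d),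
        ((∀ x, InBox (tlo L z j) (thi L z j) x → x ∈ (ι a).Ω j) ∨ (∀ x, InBox (tlo L (z + e μ) j) (thi L (z + e μ) j) x → x ∈ (ι a).Ω j)) →
        ‖(avgIter L (mulCfg U' U₀) j z μ : 𝔸) - (avgIter L U₀ j z μ : 𝔸)‖ ≤ α₁) →
      (∀ b ∈ {b : Site d × Fin d | SideTouches ((ι a).Ω 0) b.1 b.2}, ‖((U' b.1 b.2 : 𝔸ˣ) : 𝔸) - 1‖ ≤ α₁) →
      (∀ m, 1 ≤ m → m < (ι a).k → ∀ (u₁ : Site d → 𝔸ˣ) (U₁ : Site d → Fin d → 𝔸ˣ) (A : Site d → Fin d → 𝔸),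
        (∀ x, u₁ x ∈ unitaryUnits 𝔸) → (∀ x, x ∉ (ι a).Ω 0 → u₁ x = 1) → mgauge U₀ u₁ U₁ = U' → Restr129 L m ((ι a).Λs m) U₀ u₁ →
        LanF a U₀ φ m U₁ →
        (∀ j, j ≤ m → ∀ b ∈ {b : Site d × Fin d | SideTouches ((ι a).Ω j) b.1 b.2},
        U₁ b.1 b.2 = cfgExp (ι a).η A b.1 b.2 ∧ IsSelfAdjoint (A b.1 b.2) ∧ ‖A b.1 b.2‖ ≤ (5 * (d : ℝ) * L * B₈ * (α₀ + α₁)) * ((L : ℝ) ^ j * (ι a).η)⁻¹) →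
        ∃ (v : Site d → 𝔸ˣ) (lam : Site d → 𝔸), (∀ x, v x ∈ unitaryUnits 𝔸) ∧ (∀ x, x ∉ (ι a).Ω 0 → v x = 1) ∧
        (∀ j, j ≤ m + 1 → ∀ b ∈ {b : Site d × Fin d | SideTouches ((ι a).Ω j) b.1 b.2}, (v b.1 : 𝔸) = ((gaugeExp lam b.1 : 𝔸ˣ) : 𝔸) ∧
        (v (b.1 + e b.2) : 𝔸) = ((gaugeExp lam (b.1 + e b.2) : 𝔸ˣ) : 𝔸)) ∧
        (∀ j, j ≤ m + 1 → ∀ b ∈ {b : Site d × Fin d | SideTouches ((ι a).Ω j) b.1 b.2},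
        ‖lam b.1‖ ≤ (8 * B₀' * (5 * (d : ℝ) * L * B₈) * (α₀ + α₁)) ∧ ((L : ℝ) ^ j * (ι a).η) * ‖covDerivFwd (ι a).η U₀ b.2 lam b.1‖ ≤ (8 * B₀' * (5 * (d : ℝ) * L * B₈) * (α₀ + α₁))) ∧
        LanF a U₀ φ (m + 1) (mgauge U₀ v⁻¹ U₁) ∧ Restr129 L (m + 1) ((ι a).Λs (m + 1)) U₀ (u₁ * v)))
    (SH59src : ∀ a : J, ∀ α₀ α₁ : ℝ, 0 < α₀ → 0 < α₁ → α₀ + α₁ ≤ cP →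
      ∀ U₀ U' : Site d → Fin d → 𝔸ˣ, (∀ x κ, U₀ x κ ∈ unitaryUnits 𝔸) → (∀ x κ, U' x κ ∈ unitaryUnits 𝔸) →
      ∀ φ : Site d → 𝔸, ((InR138 L (ι a).k (ι a).η ((ι a).Ω 0) ((ι a).Λs (ι a).k) U₀ φ ∧ (∀ x, IsSelfAdjoint (φ x)) ∧ (∀ x, x ∉ (ι a).Ω 0 → φ x = 0) ∧
          Bdd L (ι a).k (ι a).η (-(2 : ℝ)) (fun j (x : Site d) => x ∈ (ι a).Ω j) φ) ∧
        msup L (ι a).k (ι a).η (-(2 : ℝ)) (fun j (x : Site d) => x ∈ (ι a).Ω j) φ < γ * (α₀ + α₁)) →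
      InAk L (ι a).k (ι a).η α₀ (ι a).Ω U₀ → InAk L (ι a).k (ι a).η α₀ (ι a).Ω (mulCfg U' U₀) → (∀ m, m ≤ (ι a).k → InAx L m ((ι a).Λs m) U₀ (mulCfg U' U₀)) →
      (∀ j, j ≤ (ι a).k → ∀ (z : Site d) (μ : Fin d),
        ((∀ x, InBox (tlo L z j) (thi L z j) x → x ∈ (ι a).Ω j) ∨ (∀ x, InBox (tlo L (z + e μ) j) (thi L (z + e μ) j) x → x ∈ (ι a).Ω j)) →
        ‖(avgIter L (mulCfg U' U₀) j z μ : 𝔸) - (avgIter L U₀ j z μ : 𝔸)‖ ≤ α₁) →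
      (∀ b ∈ {b : Site d × Fin d | SideTouches ((ι a).Ω 0) b.1 b.2}, ‖((U' b.1 b.2 : 𝔸ˣ) : 𝔸) - 1‖ ≤ α₁) →
      (∀ m, 1 ≤ m → m ≤ (ι a).k → ∀ (u : Site d → 𝔸ˣ) (W : Site d → Fin d → 𝔸ˣ) (A' : Site d → Fin d → 𝔸),
        (∀ x, u x ∈ unitaryUnits 𝔸) → mgauge U₀ u W = U' → Restr129 L m ((ι a).Λs m) U₀ u → LanF a U₀ φ m W →
        (∀ y τ, IsSelfAdjoint (A' y τ)) →
        (∀ j, j ≤ m → ∀ y τ, SideTouches ((ι a).Ω j) y τ →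
        W y τ = cfgExp (ι a).η A' y τ ∧ ‖A' y τ‖ ≤ (2 * (L * (5 * (d : ℝ) * L * B₈ * (α₀ + α₁))) + 8 * (8 * B₀' * (5 * (d : ℝ) * L * B₈) * (α₀ + α₁))) * ((L : ℝ) ^ j * (ι a).η)⁻¹) →
        (∀ y τ, (∀ j, j ≤ m → ¬ SideTouches ((ι a).Ω j) y τ) → A' y τ = 0) →
        msup L m (ι a).η (-(1 : ℝ)) (fun j (b : Site d × Fin d) => SideTouches ((ι a).Ω j) b.1 b.2) (fun b => A' b.1 b.2)
        ≤ B₀ * (bondNorm L m (ι a).η (-(3 : ℝ)) (ι a).Ω (fun x μ => Jcur (ι a).η U₀ A' μ x)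
        + wsup 1 (fun p : {p : ℕ × (Site d × Fin d) // p.1 ≤ m ∧ p.2 ∈ towerBondsP L (ι a).Ω ((ι a).Λs m) p.1} =>
        linCovIter L U₀ (iEta (ι a).η A') p.1.1 p.1.2.1 p.1.2.2)) + γ' * B₀ * (α₀ + α₁) ∧
        msup L m (ι a).η (-(2 : ℝ)) (fun j (t : Fin d × Fin d × Site d) => SideTouches ((ι a).Ω j) t.2.2 t.2.1)
        (fun t => covDerivFwd (ι a).η U₀ t.1 (fun z => A' z t.2.1) t.2.2)
        ≤ B₀ * (bondNorm L m (ι a).η (-(3 : ℝ)) (ι a).Ω (fun x μ => Jcur (ι a).η U₀ A' μ x)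
        + wsup 1 (fun p : {p : ℕ × (Site d × Fin d) // p.1 ≤ m ∧ p.2 ∈ towerBondsP L (ι a).Ω ((ι a).Λs m) p.1} =>
        linCovIter L U₀ (iEta (ι a).η A') p.1.1 p.1.2.1 p.1.2.2)) + γ' * B₀ * (α₀ + α₁)))
    (SP5u : ∀ a : J, ∀ α₀ α₁ : ℝ, 0 < α₀ → 0 < α₁ → α₀ + α₁ ≤ cP →
      ∀ U₀ U' : Site d → Fin d → 𝔸ˣ, (∀ x κ, U₀ x κ ∈ unitaryUnits 𝔸) → (∀ x κ, U' x κ ∈ unitaryUnits 𝔸) →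
      ∀ φ : Site d → 𝔸, ((InR138 L (ι a).k (ι a).η ((ι a).Ω 0) ((ι a).Λs (ι a).k) U₀ φ ∧ (∀ x, IsSelfAdjoint (φ x)) ∧ (∀ x, x ∉ (ι a).Ω 0 → φ x = 0) ∧
          Bdd L (ι a).k (ι a).η (-(2 : ℝ)) (fun j (x : Site d) => x ∈ (ι a).Ω j) φ) ∧
        msup L (ι a).k (ι a).η (-(2 : ℝ)) (fun j (x : Site d) => x ∈ (ι a).Ω j) φ < γ * (α₀ + α₁)) →
      InAk L (ι a).k (ι a).η α₀ (ι a).Ω U₀ → InAk L (ι a).k (ι a).η α₀ (ι a).Ω (mulCfg U' U₀) → (∀ m, m ≤ (ι a).k → InAx L m ((ι a).Λs m) U₀ (mulCfg U' U₀)) →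
      (∀ j, j ≤ (ι a).k → ∀ (z : Site d) (μ : Fin d),
        ((∀ x, InBox (tlo L z j) (thi L z j) x → x ∈ (ι a).Ω j) ∨ (∀ x, InBox (tlo L (z + e μ) j) (thi L (z + e μ) j) x → x ∈ (ι a).Ω j)) →
        ‖(avgIter L (mulCfg U' U₀) j z μ : 𝔸) - (avgIter L U₀ j z μ : 𝔸)‖ ≤ α₁) →
      (∀ b ∈ {b : Site d × Fin d | SideTouches ((ι a).Ω 0) b.1 b.2}, ‖((U' b.1 b.2 : 𝔸ˣ) : 𝔸) - 1‖ ≤ α₁) →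
      ∀ u₁ : Site d → 𝔸ˣ, (∀ x, u₁ x ∈ unitaryUnits 𝔸) → (∀ x, x ∉ (ι a).Ω 0 → u₁ x = 1) → Restr129 L (ι a).k ((ι a).Λs (ι a).k) U₀ u₁ →
      LanF a U₀ φ (ι a).k (mgauge U₀ u₁⁻¹ U') →
      (∃ A₁ : Site d → Fin d → 𝔸, ∀ j, j ≤ (ι a).k → ∀ (x : Site d) (κ : Fin d), SideTouches ((ι a).Ω j) x κ →
        mgauge U₀ u₁⁻¹ U' x κ = cfgExp (ι a).η A₁ x κ ∧ ‖A₁ x κ‖ ≤ (5 * (d : ℝ) * L * B₈ * (α₀ + α₁)) * ((L : ℝ) ^ j * (ι a).η)⁻¹) →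
      ∀ (v w : Site d → 𝔸ˣ) (lam mu : Site d → 𝔸),
      (∀ x, ((gaugeExp lam x : 𝔸ˣ) : 𝔸) = ((v x : 𝔸ˣ) : 𝔸) ∧ IsSelfAdjoint (lam x) ∧ ‖lam x‖ < cu) → (∀ x, x ∉ (ι a).Ω 0 → lam x = 0) →
      (∀ j, j ≤ (ι a).k → ∀ b ∈ {b : Site d × Fin d | SideTouches ((ι a).Ω j) b.1 b.2}, ((L : ℝ) ^ j * (ι a).η) * ‖covDerivFwd (ι a).η U₀ b.2 lam b.1‖ < cu) →
      (∀ x, ((gaugeExp mu x : 𝔸ˣ) : 𝔸) = ((w x : 𝔸ˣ) : 𝔸) ∧ IsSelfAdjoint (mu x) ∧ ‖mu x‖ < cu) → (∀ x, x ∉ (ι a).Ω 0 → mu x = 0) →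
      (∀ j, j ≤ (ι a).k → ∀ b ∈ {b : Site d × Fin d | SideTouches ((ι a).Ω j) b.1 b.2}, ((L : ℝ) ^ j * (ι a).η) * ‖covDerivFwd (ι a).η U₀ b.2 mu b.1‖ < cu) →
      LanF a U₀ φ (ι a).k (mgauge U₀ v⁻¹ (mgauge U₀ u₁⁻¹ U')) → Restr129 L (ι a).k ((ι a).Λs (ι a).k) U₀ (u₁ * v) →
      LanF a U₀ φ (ι a).k (mgauge U₀ w⁻¹ (mgauge U₀ u₁⁻¹ U')) → Restr129 L (ι a).k ((ι a).Λs (ι a).k) U₀ (u₁ * w) →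
      ∀ x, v x = w x)
    (SP3src : ∀ a : J, ∀ α₀ α₁ α₂ : ℝ, 0 < α₀ → α₀ ≤ cP3 → 0 < α₁ → α₁ ≤ cP3 → 0 < α₂ → α₂ ≤ cP3 →
      2 * α₂ ^ 2 + 20 * d * α₀ * α₂ + 2 * (2097152 * ((d : ℝ) + 1) ^ 2 * (L : ℝ) ^ 2) * α₂ ^ 2 ≤ α₀ + α₁ →
      ∀ (U₀ : (zdGF3HP₂ 𝔸 L β len (ι a)).Cfg) (P' : (zdGF3HP₂ 𝔸 L β len (ι a)).Pert) (f : Site d → 𝔸),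
        (zdGF3HP₂ 𝔸 L β len (ι a)).InR U₀ f → (zdGF3HP₂ 𝔸 L β len (ι a)).fNorm f < γ * (α₀ + α₁) → (zdGF3HP₂ 𝔸 L β len (ι a)).fGrad U₀ f < γ * (α₀ + α₁) →
        (zdGF3HP₂ 𝔸 L β len (ι a)).InA α₀ U₀ → (zdGF3HP₂ 𝔸 L β len (ι a)).InAPair α₀ U₀ P' → (zdGF3HP₂ 𝔸 L β len (ι a)).C162 1 α₂ U₀ P' →
        (zdGF3HP₂ 𝔸 L β len (ι a)).LandauF U₀ f P' → (zdGF3HP₂ 𝔸 L β len (ι a)).C137 α₁ U₀ P' →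
        (zdGF3HP₂ 𝔸 L β len (ι a)).C136 (5 * d * L * B₈) (5 * d * L * B₀β) (α₀ + α₁) U₀ P' ∧
          (zdGF3HP₂ 𝔸 L β len (ι a)).C139 (5 * d * L * B₈) (α₀ + α₁) U₀ P')
    -- the period map and three periodicity binders of transfer′ ((1.5) p. 77 read on the universal cover of `T_η`; `hΛbP` is not needed here)
    (p : J → ℕ)
    (hΩ : ∀ a l, IsPeriodic (p a) (fun x : Site d => x ∈ (ι a).Ω l))
    (hdvd : ∀ a, L ^ (ι a).k ∣ p a)
    (hΛs : ∀ a l, l ≤ (ι a).k → IsPeriodic (p a / L ^ l) (fun y : Site d => y ∈ (ι a).Λs (ι a).k l)) :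
    B8Thm8Surviving.Thm8SurvivingAt γ (5 * (d : ℝ) * L * B₈ * (1 + 11 * (d : ℝ) ^ 2)) (5 * (d : ℝ) * L * B₀β * (1 + 11 * (d : ℝ) ^ 2))
      (fun a : J => zdGF3HP₂Per 𝔸 L β len (ι a) (p a)) := by
  have hL1 : 1 ≤ L := le_trans (by norm_num) hL
  have hd1 : 1 ≤ d := le_trans (by norm_num) hd2
  -- the ℤᵈ surviving form (existence, clauses, strong uniqueness) and Theorem 8's Theorem-4-shaped core (weak uniqueness ⇒ periodicity)
  obtain ⟨c8, hc8, H8⟩ := thm8SurvivingAt_zdGF3HP₂_map_lanE_γ' (𝔸 := 𝔸) (β := β) (len := len) hd2 hL hB₀ hB₀' hcu hcP hcP3 hγ hγ' hB₈ hB₀8 hB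
    hγB ι hΩ0 htw LanF hLanF SP5base SP5 SH59src SP5u SP3src
  obtain ⟨c4, hc4, H4⟩ := thm4Core_zdGF3HP_map_lanE_γ' (𝔸 := 𝔸) (β := β) (len := len) hd2 hL hB₀ hB₀' hcu hcP (Φ := Site d → 𝔸) hγ' hB₈ hB₀8 hB
    hγB ι (fun a f U₀ a0 b0 => (InR138 L (ι a).k (ι a).η ((ι a).Ω 0) ((ι a).Λs (ι a).k) U₀ f ∧ (∀ x, IsSelfAdjoint (f x)) ∧ (∀ x, x ∉ (ι a).Ω 0 → f x = 0) ∧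
        Bdd L (ι a).k (ι a).η (-(2 : ℝ)) (fun j (x : Site d) => x ∈ (ι a).Ω j) f) ∧
      msup L (ι a).k (ι a).η (-(2 : ℝ)) (fun j (x : Site d) => x ∈ (ι a).Ω j) f < γ * (a0 + b0)) LanF SP5base SP5 SH59src SP5u
  obtain ⟨cw, hcw, hw⟩ := thm4_windows hd1 hL1 hB₈ hB₀' hB
  -- constants and the threshold
  set D : ℝ := 1 + 11 * (d : ℝ) ^ 2 with hD_def
  have hD1 : 1 ≤ D := le_add_of_nonneg_right (by positivity)
  have hD0 : 0 < D := lt_of_lt_of_le one_pos hD1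
  set cT : ℝ := min c8 (min (c4 / D) (min (cw / D) (1 / (6 * D)))) with hcT_def
  have hcT : 0 < cT := lt_min hc8 (lt_min (div_pos hc4 hD0) (lt_min (div_pos hcw hD0) (by positivity)))
  refine ⟨cT, hcT, ?_⟩
  intro a α₀ α₁ hα₀ hα₁ hs U₀ P f hInA hReg hInAAx havg hInR hf
  -- THEOREM 8 (surviving) on ℤᵈ, at the underlying fields of the periodic data
  obtain ⟨u, hR, hcl, huniq⟩ :=
    H8 a α₀ α₁ hα₀ hα₁ (hs.trans (min_le_left _ _)) (cfgZdH U₀) (pertZdH P) (srcZdH f) hInA hReg hInAAx havg hInR hf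
  obtain ⟨h162, h137, hLF, h136139⟩ := hcl
  -- thresholds at `D(α₀ + α₁)`
  have hle : ∀ {c : ℝ}, cT ≤ c / D → D * (α₀ + α₁) ≤ c := by
    intro c hc
    have h1 : α₀ + α₁ ≤ c / D := hs.trans hc
    calc D * (α₀ + α₁) ≤ D * (c / D) := mul_le_mul_of_nonneg_left h1 hD0.le
      _ = c := by field_simp
  have hs4 : D * (α₀ + α₁) ≤ c4 := hle ((min_le_right _ _).trans (min_le_left _ _))
  have hsw : D * (α₀ + α₁) ≤ cw := hle ((min_le_right _ _).trans ((min_le_right _ _).trans (min_le_left _ _)))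
  have hs6 : D * (α₀ + α₁) ≤ 1 / 6 := by
    have h1 : α₀ + α₁ ≤ 1 / (6 * D) := hs.trans ((min_le_right _ _).trans ((min_le_right _ _).trans (min_le_right _ _)))
    calc D * (α₀ + α₁) ≤ D * (1 / (6 * D)) := mul_le_mul_of_nonneg_left h1 hD0.le
      _ = 1 / 6 := by field_simp
  -- the shifted pair `(α₀, α″)`
  set α'' : ℝ := 11 * (d : ℝ) ^ 2 * (α₀ + α₁) + α₁ with hα''_def
  have h11 : 0 ≤ 11 * (d : ℝ) ^ 2 * (α₀ + α₁) := by positivity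
  have h11' : 0 ≤ 11 * (d : ℝ) ^ 2 * α₁ := by positivity
  have hα'' : 0 < α'' := by rw [hα''_def]; linarith only [h11, hα₁]
  have hsum : α₀ + α'' = D * (α₀ + α₁) := by simp only [hα''_def, hD_def]; ring
  have hα₁'' : α₁ ≤ α'' := by rw [hα''_def]; linarith only [h11]
  have h165 : 11 * (d : ℝ) ^ 2 * α₀ + α₁ ≤ α'' := by rw [hα''_def]; linarith only [h11']
  have hSS : α₀ + α₁ ≤ α₀ + α'' := by linarith only [hα₁'']
  -- windows at the shifted pair
  obtain ⟨-, -, -, -, w5, w6, -, -, -, -, -, -, -, -, -, -, -, -⟩ :=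
    hw α₀ α'' hα₀ hα'' (hsum ▸ hsw) (5 * (d : ℝ) * L * B₈ * (α₀ + α'')) (8 * B₀' * (5 * (d : ℝ) * L * B₈) * (α₀ + α'')) rfl rfl
  have hα2 : 2 * α₀ ≤ c2' d L := by linarith only [w6, hα₀]
  have hsm : 11 * (d : ℝ) ^ 2 * α₀ + α₁ ≤ 1 / 6 := by linarith only [h165, hα₀, hsum, hs6]
  -- (1.66)₀ at `α″` on all bonds (Ω₀ = ℤᵈ): (1.65) via `B8Ineq166Univ` on the box form, which the one-end-point letter contains
  have h34 : InAk L (ι a).k (ι a).η α₀ (ι a).Ω (mulCfg P.2.1 U₀.1) := hInAAx.2.1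
  have hAx : ∀ m, m ≤ (ι a).k → InAx L m ((ι a).Λs m) U₀.1 (mulCfg P.2.1 U₀.1) := hInAAx.2.2
  have hpart' : ∀ x : Site d, ∃ j, j ≤ (ι a).k ∧ ∃ y ∈ (ι a).Λs (ι a).k j, InBox (tlo L y j) (thi L y j) x := by
    intro x
    have hx : x ∈ (ι a).Ω 0 := by rw [hΩ0 a]; trivial
    exact (ι a).hpart x hx
  have havgB : ∀ j, j ≤ (ι a).k → ∀ (z : Site d) (μ : Fin d), (∀ x, InBox (loK L j z) (bondHiK L j z μ) x → x ∈ (ι a).Ω j) →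
      ‖(avgIter L (mulCfg P.2.1 U₀.1) j z μ : 𝔸) - (avgIter L U₀.1 j z μ : 𝔸)‖ ≤ α₁ :=
    fun j hj z μ hbox => havg j hj z μ (B8LeafModelZd3P.endBlockIn_of_box L ((ι a).Ω j) j z μ hbox)
  have h66 : ∀ b ∈ {b : Site d × Fin d | SideTouches ((ι a).Ω 0) b.1 b.2}, ‖((P.2.1 b.1 b.2 : 𝔸ˣ) : 𝔸) - 1‖ ≤ α'' := by
    intro b _
    have h := norm_pert_sub_one_le_univ hd1 hL (ι a).k (η := (ι a).η) U₀.2.1 P.2.2.1 hα₀ w5 hα2 hα₁.le hsm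
      (ι a).Ω (ι a).hΩ ((ι a).Λs (ι a).k) (ι a).htower hpart' hInA h34 (hAx (ι a).k le_rfl) havgB b.1 b.2
    exact h.trans h165
  have h166 : (zdGF3HP₂ 𝔸 L β len (ι a)).avgClose166 α'' (cfgZdH U₀) (pertZdH P) :=
    ⟨fun j hj z μ hb => (havg j hj z μ hb).trans hα₁'', h66⟩
  have hfS : msup L (ι a).k (ι a).η (-(2 : ℝ)) (fun j (x : Site d) => x ∈ (ι a).Ω j) f.1 < γ * (α₀ + α'') :=
    lt_of_lt_of_le hf (mul_le_mul_of_nonneg_left hSS hγ.le)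
  -- THE THEOREM-4-SHAPED CORE at the shifted pair: its weak «exactly one»
  obtain ⟨u₄, -, -, huniq₄⟩ :=
    H4 a (htw a) α₀ α'' hα₀ hα'' (hsum ▸ hs4) (cfgZdH U₀) (pertZdH P) f.1 ⟨hInR, hfS⟩ hInA hInAAx h166
  -- `5dLB₈(α₀ + α″) = B₁(α₀ + α₁)`: the server's (1.62) IS the core's (1.62)-shape, and (1.146) is the core's `LanF` by the dictionary
  have e1 : 5 * (d : ℝ) * (L : ℝ) * B₈ * (α₀ + α'') = 5 * (d : ℝ) * L * B₈ * (1 + 11 * (d : ℝ) ^ 2) * (α₀ + α₁) := by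
    rw [hsum, hD_def]; ring
  have hC162core : ∀ w : (zdGF3HP₂ 𝔸 L β len (ι a)).GT,
      (zdGF3HP₂ 𝔸 L β len (ι a)).C162 (5 * (d : ℝ) * L * B₈ * (1 + 11 * (d : ℝ) ^ 2)) (α₀ + α₁) (cfgZdH U₀)
          ((zdGF3HP₂ 𝔸 L β len (ι a)).act (pertZdH P) w) →
        (zdGF3HP 𝔸 L β len (ι a)).C162 (5 * (d : ℝ) * L * B₈) (α₀ + α'') (cfgZdH U₀) ((zdGF3HP₂ 𝔸 L β len (ι a)).act (pertZdH P) w) := by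
    intro w hw j hj b hb
    obtain ⟨h1, h2, h3⟩ := hw j hj b hb
    exact ⟨h1, h2, by rw [e1]; exact h3⟩
  have hLanF_of : ∀ w : (zdGF3HP₂ 𝔸 L β len (ι a)).GT,
      (zdGF3HP₂ 𝔸 L β len (ι a)).LandauF (cfgZdH U₀) f.1 ((zdGF3HP₂ 𝔸 L β len (ι a)).act (pertZdH P) w) →
        LanF a U₀.1 f.1 (ι a).k ((zdGF3HP₂ 𝔸 L β len (ι a)).act (pertZdH P) w).2.1 :=
    fun w hw => (hLanF a U₀.1 f.1 _).2 hw
  have hu4 : u = u₄ := huniq₄ u hR (hLanF_of u hLF) (hC162core u h162)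
  -- abbreviations for the period lattice of the member
  have hΩv : ∀ (m : Site d) (l : ℕ) (y : Site d), y + (((p a : ℕ) : ℤ) • m) ∈ (ι a).Ω l ↔ y ∈ (ι a).Ω l :=
    fun m l y => Iff.of_eq (hΩ a l y m)
  have hvq : ∀ (m : Site d) (l : ℕ), l ≤ (ι a).k → (((p a : ℕ) : ℤ) • m) = ((L : ℤ) ^ l) • ((((p a / L ^ l : ℕ) : ℤ)) • m) :=
    fun m l hl => period_smul_eq_pow_smul ((pow_dvd_pow L hl).trans (hdvd a)) m
  have hΛsv : ∀ (m : Site d) (l : ℕ), l ≤ (ι a).k → ∀ y, y + (((p a / L ^ l : ℕ) : ℤ)) • m ∈ (ι a).Λs (ι a).k l ↔ y ∈ (ι a).Λs (ι a).k l :=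
    fun m l hl y => Iff.of_eq (hΛs a l hl y m)
  -- PERIODICITY: every period-translate of `u` is again a weak competitor of the core, hence `u`
  have hper : IsPeriodic (p a) u.1 := by
    refine B8LeafModelZdPerTransfer.isPeriodic_of_unique (β := β) (len := len) (hΩ a 0)
      (fun w => (zdGF3HP₂ 𝔸 L β len (ι a)).Restricted (cfgZdH U₀) w ∧
        LanF a U₀.1 f.1 (ι a).k ((zdGF3HP₂ 𝔸 L β len (ι a)).act (pertZdH P) w).2.1 ∧
        (zdGF3HP 𝔸 L β len (ι a)).C162 (5 * (d : ℝ) * L * B₈) (α₀ + α'') (cfgZdH U₀) ((zdGF3HP₂ 𝔸 L β len (ι a)).act (pertZdH P) w))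
      u (fun u' hu' => (huniq₄ u' hu'.1 hu'.2.1 hu'.2.2).trans hu4.symm) (fun m u' hu' => ?_)
    -- the three clauses for `u`, in concrete form: background `U₀.1`, field `W = (P.2)^{u⁻¹}`
    set W : Site d → Fin d → 𝔸ˣ := mgauge P.1.1 u.1⁻¹ P.2.1 with hW
    have hR' : Restr129 L (ι a).k ((ι a).Λs (ι a).k) U₀.1 u.1 := hR
    have hLan' : IsLandau146W L (ι a).k (ι a).η ((ι a).Ω 0) ((ι a).Λs (ι a).k) U₀.1 f.1 W := (hLanF a U₀.1 f.1 W).1 (hLanF_of u hLF)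
    have h162' : ∀ l, l ≤ (ι a).k → ∀ b ∈ {b : Site d × Fin d | SideTouches ((ι a).Ω l) b.1 b.2},
        W b.1 b.2 = cfgExp (ι a).η (logCfg (ι a).η W) b.1 b.2 ∧ IsSelfAdjoint (logCfg (ι a).η W b.1 b.2) ∧
          ‖logCfg (ι a).η W b.1 b.2‖ ≤ 5 * (d : ℝ) * L * B₈ * (α₀ + α'') * ((L : ℝ) ^ l * (ι a).η)⁻¹ := hC162core u h162
    -- translate them
    have hRt := restr129_shiftCfg_of_periodic L (ι a).k ((ι a).Λs (ι a).k) U₀.1 u.1 (fun l => (((p a / L ^ l : ℕ) : ℤ)) • m)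
      (((p a : ℕ) : ℤ) • m) (hvq m) (hΛsv m) hR'
    have hU₀v : shiftCfg (((p a : ℕ) : ℤ) • m) U₀.1 = U₀.1 := funext fun y => U₀.2.2 y m
    have hfv : shiftCfg (((p a : ℕ) : ℤ) • m) f.1 = f.1 := funext fun y => f.2 y m
    have hLant := landauFW_shiftCfg_of_periodic hL1 (ι a).k (ι a).η (hvq m) (hΩv m 0) (hΛsv m) hU₀v hfv W hLan'
    have h162t := c162_shiftCfg_of_periodic L (ι a).k (ι a).η (5 * (d : ℝ) * L * B₈ * (α₀ + α'')) (hΩv m) W h162'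
    -- read back at the ORIGINAL (periodic) data
    have hQ1v : shiftCfg (((p a : ℕ) : ℤ) • m) P.1.1 = P.1.1 := funext fun y => P.1.2.2 y m
    have hQ2v : shiftCfg (((p a : ℕ) : ℤ) • m) P.2.1 = P.2.1 := funext fun y => P.2.2.2 y m
    have hWt : mgauge P.1.1 (u'.1)⁻¹ P.2.1 = shiftCfg (((p a : ℕ) : ℤ) • m) W := by
      have hm := mgauge_shiftCfg (((p a : ℕ) : ℤ) • m) P.1.1 u.1⁻¹ P.2.1
      rw [hQ1v, hQ2v] at hm
      rw [hu']
      exact hm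
    rw [hU₀v] at hRt
    rw [← hWt] at hLant h162t
    refine ⟨?_, (hLanF a U₀.1 f.1 _).2 hLant, h162t⟩
    show Restr129 L (ι a).k ((ι a).Λs (ι a).k) U₀.1 u'.1
    rw [hu']; exact hRt
  -- the periodic solution: its clauses ARE the ℤᵈ ones; «exactly one» in the periodic class is the ℤᵈ one restricted
  refine ⟨⟨u.1, u.2, hper⟩, hR, ⟨h162, h137, hLF, h136139⟩, fun u' hR' h136' h137' h139' hLanF' => ?_⟩
  have h := huniq (gtZdH u') hR' h136' h137' h139' hLanF'
  have h1 : u'.1 = u.1 := congrArg Subtype.val h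
  exact Subtype.ext h1

end Thm8Per

end Literature.MathematicalPhysics.QuantumFieldTheory.Balaban1983to89.B8Thm8SurvivingZdGF3HP2PerMapLanEGamma

end
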